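import Literature.NumberTheory.GaloisRepresentations.LubinTateColemanRelativeKernelTwo
import Literature.NumberTheory.GaloisRepresentations.LubinTateColemanAdicFixedPoint
import HarnessLib

/-!
# `q = 2`: `𝒪_E` is `(π)`-adically complete, and de Shalit's Lemma I §3.13 TWISTED over `𝒪_E` —
# every trace-zero series is `h − u·(h^ψ ∘ f)` for a unique twisted eigen-series `h` (`𝒮_E h = π·h^ψ`)

De Shalit, *Iwasawa theory of elliptic curves with complex multiplication* (1987), Ch. I §3.13 Lemma / §3.14: over an
unramified base with Frobenius `φ`, `h ↦ h̃ = h − h^φ ∘ [p]` maps the eigen-series onto the measures on the units, and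
the inverse is the fixed point `h = g + u·(h^φ ∘ f)`.  With the generic fixed-point theorem
(`LubinTateColemanAdicFixedPoint`: any `(p)`-adically complete `S`) and the operators on `𝒪_E⟦X⟧`
(`LubinTateColemanRelativeTraceTwo`, `…KernelTwo`), for `f = πX + X²` over `F` with `|𝓀_F| = 2`,
`π = 2u`, any finite `E ⊇ F` and any ring endomorphism `ψ` of `𝒪_E` with `ψ(π) = π`:

* `isHausdorff_span_singleton`, `isPrecomplete_span_singleton` (`s ≠ 0`, `‖s‖ < 1`: `(s)`-adic Cauchy ⟹ norm-Cauchy,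
  `𝒪_E` complete, the ideals `(s^n)` closed) and ★ `isAdicComplete_span_algebraMap_pi` — **`𝒪_E` is `(π)`-adically
  complete**;
* `relTraceTwo_sub`, `relTraceTwo_C` (`𝒮_E(C c) = 2·C c`), ★ `relTraceTwo_twistedTilde_eq_zero` —
  **`𝒮_E h = π·h^ψ ⟹ 𝒮_E(h − u·(h^ψ ∘ f)) = 0`**: the twisted `h̃` lands in `ker 𝒮_E = (1 + u⁻¹X)·𝒪_E⟦f⟧`;
* ★★★ `exists_twistedTilde_eq` — **every `g ∈ 𝒪_E⟦X⟧` with `𝒮_E g = 0`, `g(0) = 0` is `h − u·(h^ψ ∘ f)` with `h(0) = 0`,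
  and then `𝒮_E h = π·h^ψ`**; ★★ `twistedTilde_injective_of_constantCoeff_eq` — uniqueness given the constant term.

Together with `relTraceTwo_eq_zero_iff` (`…KernelTwo`):
the twisted `h ↦ h̃` identifies `{h : 𝒮_E h = π h^ψ, h(0) = 0}` with `{g ∈ (1 + u⁻¹X)·𝒪_E⟦f⟧ : g(0) = 0}` — the
`𝒪_{k'}`-coefficient form of I §3.13–3.14 needed for Theorem I.3.7 over the unramified bases `k'` of the two-variable
tower (with `ψ` the Frobenius).  0 sorry, no named facts.

## References

* E. de Shalit, *Iwasawa theory of elliptic curves with complex multiplication* (1987), Ch. I §3.13 Lemma, §3.14,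
  §3.7. [deShalit1987]
-/

noncomputable section

open scoped PowerSeries.WithPiTopology

namespace Literature.NumberTheory.GaloisRepresentations
section LocalFieldRel2f

open GaloisRepresentations.IsNonarchimedeanLocalField LubinTate ValuativeRel Filter Topology

variable (F : Type*) [Field F] [ValuativeRel F] [TopologicalSpace F] [IsNonarchimedeanLocalField F]

attribute [local instance] ltNormUniformSpace ltNormIsUniformAddGroup rk1 nF nE fintypeResidueField

variable {F}
variable {π : 𝒪[F]} (hπ : (valuation F).IsUniformizer (π : F))
variable (E : IntermediateField F (AlgebraicClosure F)) [FiniteDimensional F E]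

/-! ### `𝒪_E` is `(s)`-adically complete for every non-zero non-unit `s` -/

/-- Norm bound for multiples: `‖s^n · c‖ ≤ ‖s‖^n` in `𝒪_E`. [folklore] -/
private theorem norm_pow_mul_le (s : unitBall E) (n : ℕ) (c : unitBall E) :
    ‖(((s ^ n * c : unitBall E)) : E)‖ ≤ ‖((s : unitBall E) : E)‖ ^ n := by
  rw [Subring.coe_mul, SubmonoidClass.coe_pow, norm_mul, norm_pow]
  calc ‖((s : unitBall E) : E)‖ ^ n * ‖((c : unitBall E) : E)‖ ≤ ‖((s : unitBall E) : E)‖ ^ n * 1 := by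
        gcongr; exact (mem_unitBall_iff E).mp c.2
    _ = _ := mul_one _

/-- **`𝒪_E` is `(s)`-adically Hausdorff** for `‖s‖ < 1`: `⋂_n (s^n) = 0`. [cite: deShalit1987, Ch. I §3.14] -/
theorem isHausdorff_span_singleton {s : unitBall E} (hs : ‖((s : unitBall E) : E)‖ < 1) :
    IsHausdorff (Ideal.span {s}) (unitBall E) := by
  refine ⟨fun x hx => ?_⟩
  have hx' : ∀ n : ℕ, ‖((x : unitBall E) : E)‖ ≤ ‖((s : unitBall E) : E)‖ ^ n := fun n => by
    have h := hx n
    rw [SModEq.sub_mem, sub_zero, smul_eq_mul, Ideal.mul_top, Ideal.span_singleton_pow, Ideal.mem_span_singleton] at h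
    obtain ⟨c, hc⟩ := h
    rw [hc]; exact norm_pow_mul_le E s n c
  have h0 : ‖((x : unitBall E) : E)‖ ≤ 0 :=
    ge_of_tendsto (tendsto_pow_atTop_nhds_zero_of_lt_one (norm_nonneg _) hs) (Eventually.of_forall hx')
  exact Subtype.ext (norm_le_zero_iff.mp h0)

/-- **`𝒪_E` is `(s)`-adically precomplete** for `s ≠ 0`, `‖s‖ < 1`: an `(s)`-adic Cauchy sequence is norm-Cauchy, hence
converges (`E` is complete), and the limit is `(s)`-adically the limit since the ideals `(s^n)` are closed.
[cite: deShalit1987, Ch. I §3.13] -/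
theorem isPrecomplete_span_singleton {s : unitBall E} (hs0 : s ≠ 0) (hs : ‖((s : unitBall E) : E)‖ < 1) :
    IsPrecomplete (Ideal.span {s}) (unitBall E) := by
  refine ⟨fun {f} hf => ?_⟩
  have hmem : ∀ {m n : ℕ}, m ≤ n → f n - f m ∈ Ideal.span {s ^ m} := fun {m n} hmn => by
    have h := hf hmn
    rw [SModEq.sub_mem, smul_eq_mul, Ideal.mul_top, Ideal.span_singleton_pow] at h
    rw [← neg_sub]
    exact neg_mem h
  have hdist : ∀ n, dist (f n) (f (n + 1)) ≤ 1 * ‖((s : unitBall E) : E)‖ ^ n := fun n => by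
    rw [one_mul, dist_comm, dist_eq_norm]
    obtain ⟨c, hc⟩ := Ideal.mem_span_singleton.mp (hmem (Nat.le_succ n))
    change ‖(((f (n + 1) - f n : unitBall E)) : E)‖ ≤ _
    rw [hc]; exact norm_pow_mul_le E s n c
  have hcau : CauchySeq f := cauchySeq_of_le_geometric _ _ hs hdist
  obtain ⟨L, hL⟩ := cauchySeq_tendsto_of_complete hcau
  refine ⟨L, fun n => ?_⟩
  rw [SModEq.sub_mem, smul_eq_mul, Ideal.mul_top, Ideal.span_singleton_pow]
  have hclosed : IsClosed ((Ideal.span {s ^ n} : Ideal (unitBall E)) : Set (unitBall E)) :=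
    isClosed_span_singleton_of_ne_zero E (pow_ne_zero n hs0)
  have hlim : Tendsto (fun k => f k - f n) atTop (𝓝 (L - f n)) := hL.sub tendsto_const_nhds
  have hev : ∀ᶠ k in atTop, f k - f n ∈ ((Ideal.span {s ^ n} : Ideal (unitBall E)) : Set (unitBall E)) :=
    Filter.eventually_atTop.mpr ⟨n, fun k hk => hmem hk⟩
  have := hclosed.mem_of_tendsto hlim hev
  rw [← neg_sub]
  exact neg_mem this

include hπ in
/-- ★ **`𝒪_E` is `(π)`-adically complete** (`π` the uniformizer of the base `F`), for every finite `E ⊇ F`.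
[cite: deShalit1987, Ch. I §3.13] -/
theorem isAdicComplete_span_algebraMap_pi :
    IsAdicComplete (Ideal.span {algebraMap 𝒪[F] (unitBall E) π}) (unitBall E) :=
  have hlt : ‖((algebraMap 𝒪[F] (unitBall E) π : unitBall E) : E)‖ < 1 :=
    algebraMap_mem_maxNilIdeal_of_dvd hπ (dvd_refl π)
  { toIsHausdorff := isHausdorff_span_singleton E hlt
    toIsPrecomplete := isPrecomplete_span_singleton E (algebraMap_pi_ne_zero hπ E) hlt }

/-- `f` is substitutable (`f(0) = 0`). [folklore] -/
private theorem hasSubst_mapLtSer₆ :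
    PowerSeries.HasSubst ((ltSer F π).map (algebraMap (LTCoeff F) (unitBall E))) :=
  PowerSeries.HasSubst.of_constantCoeff_zero' ((isLTSeries_ltSer π).map _).constantCoeff_eq_zero

/-! ### The twisted `h ↦ h̃ = h − u·(h^ψ ∘ f)` lands in `ker 𝒮_E` -/

/-- `𝒮_E` on differences. [cite: deShalit1987, Ch. I §3.12] -/
theorem relTraceTwo_sub (hq : residueFieldCard F = 2) (G H : PowerSeries (unitBall E)) :
    relTraceTwo hπ E hq (G - H) = relTraceTwo hπ E hq G - relTraceTwo hπ E hq H := by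
  refine subst_map_ltSer_injective hπ E ?_
  change PowerSeries.subst _ _ = PowerSeries.subst _ _
  rw [← PowerSeries.coe_substAlgHom (hasSubst_mapLtSer₆ E), map_sub, PowerSeries.coe_substAlgHom,
    subst_relTraceTwo, subst_relTraceTwo, subst_relTraceTwo, map_sub]
  ring

/-- `𝒮_E (C c) = 2·C c`. [cite: deShalit1987, Ch. I §3.12] -/
theorem relTraceTwo_C (hq : residueFieldCard F = 2) (c : unitBall E) :
    relTraceTwo hπ E hq (PowerSeries.C c) = PowerSeries.C 2 * PowerSeries.C c := by
  refine subst_map_ltSer_injective hπ E ?_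
  change PowerSeries.subst _ _ = PowerSeries.subst _ _
  rw [subst_relTraceTwo, reflE_C, ← map_mul, PowerSeries.C_eq_algebraMap, PowerSeries.C_eq_algebraMap,
    ← PowerSeries.coe_substAlgHom (hasSubst_mapLtSer₆ E), AlgHom.commutes, ← two_mul, map_mul, map_ofNat]

/-- ★ **`𝒮_E h = π·h^ψ ⟹ 𝒮_E(h − u·(h^ψ ∘ f)) = 0`** (`π = 2u`): the twisted form of de Shalit's `h ↦ h̃` (I §3.13 over
an unramified base, `ψ` its Frobenius) maps the twisted eigen-series into the trace-zero series `(1 + u⁻¹X)·𝒪_E⟦f⟧`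
(`relTraceTwo_eq_zero_iff`). [cite: deShalit1987, Ch. I §3.13] -/
theorem relTraceTwo_twistedTilde_eq_zero (hq : residueFieldCard F = 2) {u : LTCoeff F}
    (hu : LTCoeff.of F π = residueFieldCard F * u) (ψ : unitBall E →+* unitBall E) {h : PowerSeries (unitBall E)}
    (hh : relTraceTwo hπ E hq h = PowerSeries.C (algebraMap 𝒪[F] (unitBall E) π) * PowerSeries.map ψ h) :
    relTraceTwo hπ E hq (h - PowerSeries.C (algebraMap (LTCoeff F) (unitBall E) u) *
      PowerSeries.subst ((ltSer F π).map (algebraMap (LTCoeff F) (unitBall E))) (PowerSeries.map ψ h)) = 0 := by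
  have hpu : PowerSeries.C (algebraMap 𝒪[F] (unitBall E) π) =
      PowerSeries.C 2 * PowerSeries.C (algebraMap (LTCoeff F) (unitBall E) u) := by
    rw [← map_mul]
    change PowerSeries.C (algebraMap (LTCoeff F) (unitBall E) (LTCoeff.of F π)) = _
    rw [hu, hq, map_mul, map_natCast, Nat.cast_ofNat]
  rw [relTraceTwo_sub hπ E hq, relTraceTwo_mul_subst, relTraceTwo_C hπ E hq, hh, hpu]
  ring

/-! ### De Shalit's Lemma I §3.13, twisted, over `𝒪_E`: the twisted `h ↦ h̃` is onto the trace-zero series -/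

/-- ★★★ **Twisted Lemma 3.13 over `𝒪_E`** (`q = 2`, `π = 2u`, `ψ` a ring endomorphism of `𝒪_E` fixing `π`): every
`g ∈ 𝒪_E⟦X⟧` with `𝒮_E g = 0` and `g(0) = 0` is `h − u·(h^ψ ∘ f)` for a `h` with `h(0) = 0`, and that `h` satisfies the
twisted eigen-equation `𝒮_E h = π·h^ψ`. [cite: deShalit1987, Ch. I §3.13 Lemma] -/
theorem exists_twistedTilde_eq (hq : residueFieldCard F = 2) {u : LTCoeff F}
    (hu : LTCoeff.of F π = residueFieldCard F * u) {ψ : unitBall E →+* unitBall E}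
    (hψ : ψ (algebraMap 𝒪[F] (unitBall E) π) = algebraMap 𝒪[F] (unitBall E) π) {g : PowerSeries (unitBall E)}
    (hg : relTraceTwo hπ E hq g = 0) (hg0 : PowerSeries.constantCoeff g = 0) :
    ∃ h : PowerSeries (unitBall E), PowerSeries.constantCoeff h = 0 ∧
      h - PowerSeries.C (algebraMap (LTCoeff F) (unitBall E) u) *
          PowerSeries.subst ((ltSer F π).map (algebraMap (LTCoeff F) (unitBall E))) (PowerSeries.map ψ h) = g ∧
      relTraceTwo hπ E hq h = PowerSeries.C (algebraMap 𝒪[F] (unitBall E) π) * PowerSeries.map ψ h := by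
  haveI := isAdicComplete_span_algebraMap_pi hπ E
  have hf := (isLTSeries_ltSer (F := F) π).map (algebraMap (LTCoeff F) (unitBall E))
  have hf1 : algebraMap 𝒪[F] (unitBall E) π ∣
      PowerSeries.coeff 1 ((ltSer F π).map (algebraMap (LTCoeff F) (unitBall E))) := by
    rw [hf.coeff_one]; exact dvd_rfl
  obtain ⟨h, hh0, hh⟩ := exists_eq_add_C_mul_map_subst (p := algebraMap 𝒪[F] (unitBall E) π)
    hf.constantCoeff_eq_zero hf1 hψ (algebraMap (LTCoeff F) (unitBall E) u) hg0
  refine ⟨h, hh0, by rw [sub_eq_iff_eq_add]; exact hh, ?_⟩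
  -- `𝒮_E h = 𝒮_E g + u · 2 · h^ψ = π · h^ψ`
  have hpu : PowerSeries.C (algebraMap 𝒪[F] (unitBall E) π) =
      PowerSeries.C 2 * PowerSeries.C (algebraMap (LTCoeff F) (unitBall E) u) := by
    rw [← map_mul]
    change PowerSeries.C (algebraMap (LTCoeff F) (unitBall E) (LTCoeff.of F π)) = _
    rw [hu, hq, map_mul, map_natCast, Nat.cast_ofNat]
  conv_lhs => rw [hh]
  rw [relTraceTwo_add hπ E hq, hg, zero_add, relTraceTwo_mul_subst, relTraceTwo_C hπ E hq, hpu, mul_assoc]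

include hπ in
/-- ★★ **… uniquely**: `h ↦ h − u·(h^ψ ∘ f)` is injective on series with a fixed constant term.
[cite: deShalit1987, Ch. I §3.14] -/
theorem twistedTilde_injective_of_constantCoeff_eq (u : LTCoeff F) {ψ : unitBall E →+* unitBall E}
    (hψ : ψ (algebraMap 𝒪[F] (unitBall E) π) = algebraMap 𝒪[F] (unitBall E) π) {h h' : PowerSeries (unitBall E)}
    (he : h - PowerSeries.C (algebraMap (LTCoeff F) (unitBall E) u) *
        PowerSeries.subst ((ltSer F π).map (algebraMap (LTCoeff F) (unitBall E))) (PowerSeries.map ψ h) =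
      h' - PowerSeries.C (algebraMap (LTCoeff F) (unitBall E) u) *
        PowerSeries.subst ((ltSer F π).map (algebraMap (LTCoeff F) (unitBall E))) (PowerSeries.map ψ h'))
    (h0 : PowerSeries.constantCoeff h = PowerSeries.constantCoeff h') : h = h' := by
  haveI := (isAdicComplete_span_algebraMap_pi hπ E).toIsHausdorff
  have hf := (isLTSeries_ltSer (F := F) π).map (algebraMap (LTCoeff F) (unitBall E))
  have hf1 : algebraMap 𝒪[F] (unitBall E) π ∣
      PowerSeries.coeff 1 ((ltSer F π).map (algebraMap (LTCoeff F) (unitBall E))) := by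
    rw [hf.coeff_one]; exact dvd_rfl
  refine eq_of_eq_add_C_mul_map_subst (p := algebraMap 𝒪[F] (unitBall E) π) hf.constantCoeff_eq_zero hf1 hψ
    (algebraMap (LTCoeff F) (unitBall E) u)
    (g := h - PowerSeries.C (algebraMap (LTCoeff F) (unitBall E) u) *
      PowerSeries.subst ((ltSer F π).map (algebraMap (LTCoeff F) (unitBall E))) (PowerSeries.map ψ h)) ?_ ?_ h0
  · ring
  · rw [he]; ring

end LocalFieldRel2f

end Literature.NumberTheory.GaloisRepresentations
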